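import Literature.AnabelianGeometry.EtaleTheta.Discharge.Sec5PsiPreservesFrobeniusTrivial
import Literature.AnabelianGeometry.EtaleTheta.Discharge.Sec5DiscrepancyIntrinsic
import Literature.AnabelianGeometry.EtaleTheta.Discharge.Sec5Thm56
import Literature.AnabelianGeometry.EtaleTheta.Discharge.Sec3TemperedFrobenioidNotGroupLike

/-!
# [EtTh] Thm. 5.6: the unit pull-back binder `hpull` («`Ψ` preserves `O^×(−)` as a functor») — PROVED for LINEAR morphisms at the
# assembled / genuine §5 data; census note on its quantifier (pp. 327–329 / PDF pp. 101–103)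

S. Mochizuki, *The étale theta function and its Frobenioid-theoretic manifestations*, Publ. RIMS **45** (2009) [MochizukiEtTh2009],
Prop. 5.5 p.327–328 (PDF pp.101–102): «… we obtain an isomorphism `(l·Δ_Θ)_S ⊗ ℤ/Nℤ ⥲ μ_N(S)` that is functorial with respect to … LINEAR
morphisms `S″ → S` [which induce isomorphisms `μ_N(S) ⥲ μ_N(S″)`]»; Thm. 5.6 proof p.328–329 (PDF pp.102–103).  S. Mochizuki, *The
geometry of Frobenioids I* [MochizukiFrdI2008], Thm. 5.2 (i) p.100 (`u_{ψ∘φ} = Base(φ)^* u_ψ · u_φ^{deg_Fr ψ}`), Thm. 3.4 (iii)–(v) pp.62–63.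

abc-iut cell, layer L2, seat abc-iut-w5-d013 (gen 5), self-named ROW «hpull FOR LINEAR MORPHISMS» (STATUS 2026-08-26T13:2xZ).  PROOF-ONLY
(no definition, no new named fact); nothing landed is edited or restated.

THE BINDER.  Every landed Thm. 5.6 knit — abc-iut-L2-d4's `Sec5Thm56.preservesRigidityIso_of` / `cyclotomicRigidityPreserved_of`, the
capstones `Sec5Thm56Capstone`, abc-iut-w5-d034's K4 END KNITS (`Sec5Thm56EndKnitLevelN(Carrier/ProjPin/Ydd)`) — carries
`hpull : ∀ {A A'} (φ : A ⟶ A') (u : μ_N(A')) (hu : Ψ u ∈ μ_N(Ψ A')), Ψ (φ^* u) = (Ψ φ)^* (Ψ u)`  («`Ψ` preserves `O^×(−)` as a functor»,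
[FrdI] Thm. 3.4 (iv)), quantified over ALL morphisms `φ`.
* WHAT IS PROVED HERE: the clause for LINEAR `φ` (`deg_Fr φ = 1`), at abc-iut-L2-t4's `𝔉 := ofBiKummerData …` over ANY base and at the
  genuine data `ofConnectedTemperoidData …` (`hpull_of_isLinear_ofBiKummerData`, `…_ofConnectedTemperoidData`): the pulled-back unit
  `φ^* u` is THE unit of `A` lying under the linear `φ` over `u` (`(φ^* u) ≫ φ = φ ≫ u`, abc-iut-L1's `ModelFrobenioid.comp_eq_unitsPull_comp`,
  and such a unit is UNIQUE — `TemperedFrobenioid.eq_of_under_of_linear`, from abc-iut-L2-d4's `unit_eq_pull_of_over`); `Ψ` carries that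
  intertwining square to the one for `Ψ φ` (a functor), `Ψ φ` is linear ([FrdI] Thm. 3.4 (iii), abc-iut-L2-d4's `preservesLinear_of_model`) and
  `Ψ (φ^* u)` is a unit (`mapAut_mem_units` over the 1-compatible `Ψ^bs` of [FrdI] Thm. 3.4 (v), produced by this seat's
  `exists_psiBase_frobeniusType_degFr`) — so it IS `(Ψ φ)^* (Ψ u)`.
* CENSUS NOTE (for the K4 custodian / abc-iut-L2-lead; no landed statement is touched): print's Prop. 5.5 asserts the functoriality of
  `(l·Δ_Θ)_S ⊗ ℤ/Nℤ ⥲ μ_N(S)` for LINEAR morphisms only, and the landed proof `Sec5Thm56.preservesRigidityIso_of` APPLIES `hpull` only under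
  `hφ : 𝔉.IsLinear φ` (inside `IsFunctorialLinear`); the all-`φ` quantifier of the binder is stronger than what is used.  For a morphism of
  Frobenius degree `d > 1` the model's intertwining relation reads `u′ ≫ φ = φ ≫ u ⇔ (u_{u′})^d = Base(φ)^* u_u` ([FrdI] Thm. 5.2 (i)), which pins
  `φ^* u` only up to `d`-torsion of `O^×(A)`, so the route of this file does not extend; whether the all-`φ` form holds for an arbitrary
  self-equivalence is left OPEN here (it would need the unit-level transport of [FrdI] Cor. 4.10 / Thm. 5.2 (ii) "Moreover").  A v-next knit with the
  binder restricted to linear `φ` (`hpullLin` below is its exact shape) has it DISCHARGED by this file.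
HONEST FRAMING: kernel-checked identities of the model vocabulary; [EtTh]/[FrdI] are refereed pre-IUT material; nothing here bears on [IUTchIII]
Cor. 3.12 — no side is taken; typed ≠ proved for any genuine datum.
-/

noncomputable section

namespace Literature.AnabelianGeometry.EtaleTheta

open CategoryTheory Opposite Literature.AlgebraicGeometry.Frobenioids Literature.AnabelianGeometry.SemiGraphs

/-! ### 1. Units lying under a linear morphism are unique ([FrdI] Thm. 5.2 (i)) -/

namespace TemperedFrobenioid

universe u₀ v₀ u v w

variable {D₀ : Type u₀} [Category.{v₀} D₀] {V : FrdIMonoidStub.{w}} {T : RealifiedDivisorMonoids (D₀ := D₀) V}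
  {D : Type u} [Category.{v} D] {VD : FrdICatStub.{u, v, w} D} (C : TemperedFrobenioid T D VD)

/-- **The unit lying UNDER a linear morphism over a given unit is unique** ([FrdI] Thm. 5.2 (i)): if `ε′, ε″ ∈ O^×(A)`, `δ ∈ O^×(B)`,
`s : A → B` is linear and `ε′ ≫ s = s ≫ δ`, `ε″ ≫ s = s ≫ δ`, then `ε′ = ε″` (both have unit coordinate `Base(s)^* u_δ`, abc-iut-L2-d4's
`unit_eq_pull_of_over`; `Div = 0` on units for divisorial `Φ`).  [cite: MochizukiFrdI2008, Thm. 5.2 (i) p.100] -/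
theorem eq_of_under_of_linear (hΦd : Objectwise (fun M _ => IsDivisorial M) C.divisorMonoid) {A B : C.category}
    {s : A ⟶ B} (hs : ModelFrobenioid.degFr s = 1) {ε' ε'' : Aut A} (hε' : ε' ∈ ModelFrobenioid.units A)
    (hε'' : ε'' ∈ ModelFrobenioid.units A) {δ : Aut B} (hδ : δ ∈ ModelFrobenioid.units B)
    (h' : ε'.hom ≫ s = s ≫ δ.hom) (h'' : ε''.hom ≫ s = s ≫ δ.hom) : ε' = ε'' := by
  have e' := C.unit_eq_pull_of_over hs hε' hδ h'
  have e'' := C.unit_eq_pull_of_over hs hε'' hδ h''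
  exact Iso.ext (ModelFrobenioid.hom_ext (hε'.2.trans hε''.2.symm) (hε'.1.trans hε''.1.symm)
    (by rw [ModelFrobenioid.div_eq_one_of_mem_units (hΦd A.base).isSharp hε',
      ModelFrobenioid.div_eq_one_of_mem_units (hΦd A.base).isSharp hε'']) (e'.trans e''.symm))

end TemperedFrobenioid

namespace ThetaFrobenioid

universe u₀ v₀ u v w

/-! ### 2. `hpull` for LINEAR `φ` at abc-iut-L2-t4's assembled §5 data `ofBiKummerData` (any base) -/

section OfBiKummerData

variable {K : Type u₀} [Field K]
  {X : SemiGraphs.TemperedArithmeticGroup.{u₀} K} {D₀ : Type u₀} [Category.{v₀} D₀]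
  {V : FrdIMonoidStub.{w}} {T₀ : RealifiedDivisorMonoids (D₀ := D₀) V} {D : Type u} [Category.{v} D]
  {VD : FrdICatStub.{u, v, w} D} {S : BiKummerSetting X T₀ D VD}
  {pullFrac : ∀ {A A' : S.C} (_ : A' ⟶ A), S.biratUnits A → S.biratUnits A'}
  {lv N : ℕ+} {T : ThetaEnvData.{max v w} N} {θr : S.biratUnits S.Aodot} {Bl : S.C}
  {Pl : S.FractionPair θr Bl} {Rl : S.NthRoot θr Pl lv pullFrac}
  (h : ModelFrobenioid.Hypotheses S.tf.divisorMonoid S.tf.ratFnFunctor)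
  (toB : ∀ A : S.C, S.biratUnits A →* S.tf.biratUnitsModel A)
  (Q : FrobenioidTheta.ThetaSubquotientStub.{w} D) (odd_l : Odd (lv : ℕ)) (R : S.NthRoot Rl.root Rl.pair N pullFrac)
  (ιX : T.PiX ≃ₜ* X.Pi) (hopen : IsOpen ((S.galoisSurj R.AN.base R.αData.isGalois).ker : Set X.Pi))
  (σ : Aut R.AN.base →* Aut R.AN) (K' : Type w) [Field K'] (constEmb : K'ˣ →* S.tf.biratUnitsModel R.BN)
  (constEmb_injective : Function.Injective constEmb)
  (hdivc : ∀ g : Aut R.BN.base,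
    ModelFrobenioid.div ((σ ((BiKummerSetting.NthRoot.baseIso S R).conjAut.symm g)).hom ≫ R.pair.num) =
      ModelFrobenioid.div R.pair.num)
  (hdivp : ∀ y : T.PiYdd,
    ModelFrobenioid.div ((σ (S.galoisSurj R.AN.base R.αData.isGalois (ιX y.1))).hom ≫ R.pair.den) =
      ModelFrobenioid.div R.pair.den)

/-- **`hpull` for a LINEAR `φ`, GIVEN a 1-compatible `Ψ^bs` and «`Ψ φ` linear»** — at `𝔉 := ofBiKummerData …`: for `φ : A → A′` linear with
`Ψ φ` linear, `u ∈ μ_N(A′)` with `Ψ u ∈ μ_N(Ψ A′)`: `Ψ (φ^* u) = (Ψ φ)^* (Ψ u)` in `Aut(Ψ A)`.  (`φ^* u ≫ φ = φ ≫ u` is carried by the functor `Ψ`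
to a unit of `Ψ A` lying under `Ψ φ` over `Ψ u`; such a unit is unique, §1.)  [cite: MochizukiEtTh2009, Prop 5.5 p.328 (PDF p.102)] -/
theorem hpull_of_isLinear_ofBiKummerData_of_compat (Ψ : S.C ≌ S.C) (Ψbs : D ⥤ D)
    (eΨ : Ψ.functor ⋙ (ofBiKummerData h toB Q odd_l R ιX hopen σ K' constEmb constEmb_injective hdivc hdivp).base ≅
      (ofBiKummerData h toB Q odd_l R ιX hopen σ K' constEmb constEmb_injective hdivc hdivp).base ⋙ Ψbs)
    {A A' : S.C} (φ : A ⟶ A') (hφ : (ofBiKummerData h toB Q odd_l R ιX hopen σ K' constEmb constEmb_injective hdivc hdivp).IsLinear φ)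
    (hΨφ : (ofBiKummerData h toB Q odd_l R ιX hopen σ K' constEmb constEmb_injective hdivc hdivp).IsLinear (Ψ.functor.map φ))
    (u : (ofBiKummerData h toB Q odd_l R ιX hopen σ K' constEmb constEmb_injective hdivc hdivp).muTorsion A'
      (ofBiKummerData h toB Q odd_l R ιX hopen σ K' constEmb constEmb_injective hdivc hdivp).N)
    (hu : Functor.mapAut A' Ψ.functor (u : Aut A') ∈
      (ofBiKummerData h toB Q odd_l R ιX hopen σ K' constEmb constEmb_injective hdivc hdivp).muTorsion (Ψ.functor.obj A')
        (ofBiKummerData h toB Q odd_l R ιX hopen σ K' constEmb constEmb_injective hdivc hdivp).N) :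
    Functor.mapAut A Ψ.functor
        ((ofBiKummerData h toB Q odd_l R ιX hopen σ K' constEmb constEmb_injective hdivc hdivp).muTorsionPull φ
          (ofBiKummerData h toB Q odd_l R ιX hopen σ K' constEmb constEmb_injective hdivc hdivp).N u : Aut A) =
      ((ofBiKummerData h toB Q odd_l R ιX hopen σ K' constEmb constEmb_injective hdivc hdivp).muTorsionPull (Ψ.functor.map φ)
          (ofBiKummerData h toB Q odd_l R ιX hopen σ K' constEmb constEmb_injective hdivc hdivp).N ⟨_, hu⟩ : Aut (Ψ.functor.obj A)) := by
  -- the two candidates are units of `Ψ A`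
  have h₁ : Functor.mapAut A Ψ.functor
      ((ofBiKummerData h toB Q odd_l R ιX hopen σ K' constEmb constEmb_injective hdivc hdivp).muTorsionPull φ
        (ofBiKummerData h toB Q odd_l R ιX hopen σ K' constEmb constEmb_injective hdivc hdivp).N u : Aut A) ∈
      (ofBiKummerData h toB Q odd_l R ιX hopen σ K' constEmb constEmb_injective hdivc hdivp).units (Ψ.functor.obj A) :=
    mapAut_mem_units Ψ Ψbs eΨ
      ((ofBiKummerData h toB Q odd_l R ιX hopen σ K' constEmb constEmb_injective hdivc hdivp).muTorsion_le_units _ _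
        ((ofBiKummerData h toB Q odd_l R ιX hopen σ K' constEmb constEmb_injective hdivc hdivp).muTorsionPull φ _ u).2)
  have h₂ := (ofBiKummerData h toB Q odd_l R ιX hopen σ K' constEmb constEmb_injective hdivc hdivp).muTorsion_le_units _ _
    ((ofBiKummerData h toB Q odd_l R ιX hopen σ K' constEmb constEmb_injective hdivc hdivp).muTorsionPull (Ψ.functor.map φ) _ ⟨_, hu⟩).2
  have hΨu := (ofBiKummerData h toB Q odd_l R ιX hopen σ K' constEmb constEmb_injective hdivc hdivp).muTorsion_le_units _ _ hu
  -- both lie under the linear `Ψ φ` over `Ψ u`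
  have e₁ : (Functor.mapAut A Ψ.functor
      ((ofBiKummerData h toB Q odd_l R ιX hopen σ K' constEmb constEmb_injective hdivc hdivp).muTorsionPull φ
        (ofBiKummerData h toB Q odd_l R ιX hopen σ K' constEmb constEmb_injective hdivc hdivp).N u : Aut A)).hom ≫ Ψ.functor.map φ =
      Ψ.functor.map φ ≫ (Functor.mapAut A' Ψ.functor (u : Aut A')).hom := by
    change Ψ.functor.map _ ≫ Ψ.functor.map φ = Ψ.functor.map φ ≫ Ψ.functor.map _
    rw [← Functor.map_comp, ← Functor.map_comp]
    exact congrArg Ψ.functor.map (ModelFrobenioid.comp_eq_unitsPull_comp φ hφ ⟨(u : Aut A'), u.2.1⟩)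
  have e₂ : ((ofBiKummerData h toB Q odd_l R ιX hopen σ K' constEmb constEmb_injective hdivc hdivp).muTorsionPull (Ψ.functor.map φ)
        (ofBiKummerData h toB Q odd_l R ιX hopen σ K' constEmb constEmb_injective hdivc hdivp).N ⟨_, hu⟩ : Aut (Ψ.functor.obj A)).hom ≫
        Ψ.functor.map φ = Ψ.functor.map φ ≫ (Functor.mapAut A' Ψ.functor (u : Aut A')).hom :=
    ModelFrobenioid.comp_eq_unitsPull_comp (Ψ.functor.map φ) hΨφ ⟨_, hΨu⟩
  exact S.tf.eq_of_under_of_linear h.isDivisorial hΨφ h₁ h₂ hΨu e₁ e₂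

include h in
/-- **`hpull` for LINEAR `φ` at `𝔉 := ofBiKummerData …`** over a slim base of FSM-type (`Φ` non-dilating — the model
hypothesis of every §5 knit; «a non-group-like object» is abc-iut-w4-d008's theorem `exists_not_isGroupLikeObj`): for EVERY self-equivalence `Ψ`, every linear `φ : A → A′`, every `u ∈ μ_N(A′)` with `Ψ u ∈ μ_N(Ψ A′)`:
`Ψ (φ^* u) = (Ψ φ)^* (Ψ u)`.  Inputs discharged: `Ψ^bs` ([FrdI] Thm. 3.4 (v), `BiKummerSetting.exists_psiBase_frobeniusType_degFr`) and «`Ψ φ`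
linear» ([FrdI] Thm. 3.4 (iii), abc-iut-L2-d4's `preservesLinear_of_model`).  [cite: MochizukiEtTh2009, Prop 5.5 p.328 (PDF p.102)] -/
theorem hpull_of_isLinear_ofBiKummerData (hD : IsOfFSMType D) (hslim : IsSlim D) (hnd : IsNonDilatingOn S.tf.divisorMonoid)
    (Ψ : S.C ≌ S.C) {A A' : S.C} (φ : A ⟶ A')
    (hφ : (ofBiKummerData h toB Q odd_l R ιX hopen σ K' constEmb constEmb_injective hdivc hdivp).IsLinear φ)
    (u : (ofBiKummerData h toB Q odd_l R ιX hopen σ K' constEmb constEmb_injective hdivc hdivp).muTorsion A'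
      (ofBiKummerData h toB Q odd_l R ιX hopen σ K' constEmb constEmb_injective hdivc hdivp).N)
    (hu : Functor.mapAut A' Ψ.functor (u : Aut A') ∈
      (ofBiKummerData h toB Q odd_l R ιX hopen σ K' constEmb constEmb_injective hdivc hdivp).muTorsion (Ψ.functor.obj A')
        (ofBiKummerData h toB Q odd_l R ιX hopen σ K' constEmb constEmb_injective hdivc hdivp).N) :
    Functor.mapAut A Ψ.functor
        ((ofBiKummerData h toB Q odd_l R ιX hopen σ K' constEmb constEmb_injective hdivc hdivp).muTorsionPull φ
          (ofBiKummerData h toB Q odd_l R ιX hopen σ K' constEmb constEmb_injective hdivc hdivp).N u : Aut A) =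
      ((ofBiKummerData h toB Q odd_l R ιX hopen σ K' constEmb constEmb_injective hdivc hdivp).muTorsionPull (Ψ.functor.map φ)
          (ofBiKummerData h toB Q odd_l R ιX hopen σ K' constEmb constEmb_injective hdivc hdivp).N ⟨_, hu⟩ : Aut (Ψ.functor.obj A)) := by
  -- «a non-group-like object» is a THEOREM for every tempered Frobenioid (abc-iut-w4-d008's `exists_not_isGroupLikeObj`, Def. 3.6 (ii)(b))
  have hN := S.exists_not_isGroupLikeObj
  obtain ⟨Ψbs, -, eΨ, -, -, -⟩ := S.exists_psiBase_frobeniusType_degFr h hD hslim hnd hN Ψ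
  exact hpull_of_isLinear_ofBiKummerData_of_compat h toB Q odd_l R ιX hopen σ K' constEmb constEmb_injective hdivc hdivp Ψ Ψbs eΨ φ hφ
    (preservesLinear_of_model (𝔉 := ofBiKummerData h toB Q odd_l R ιX hopen σ K' constEmb constEmb_injective hdivc hdivp) rfl h hD
      hnd hN Ψ φ hφ) u hu

end OfBiKummerData

/-! ### 3. `hpull` for LINEAR `φ` at the genuine §5 data over `B^temp(Π^tp_X)⁰` -/

section ConnectedTemperoidData

variable {K : Type u₀} [Field K] {X : SemiGraphs.TemperedArithmeticGroup.{u₀} K} {D₀ : Type u₀} [Category.{v₀} D₀]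
  {V : FrdIMonoidStub.{w}} {T₀ : RealifiedDivisorMonoids (D₀ := D₀) V}
  {VD : FrdICatStub.{u₀ + 1, u₀, w} (ConnectedPart (BTemp X.Pi))}
  {tf : TemperedFrobenioid T₀ (ConnectedPart (BTemp X.Pi)) VD} {hZ : tf.monoidType = MonoidType.Z}
  {hP : ∀ A : (ConnectedPart (BTemp X.Pi))ᵒᵖ, IsPerfect (tf.Φ.carrier A)}
  {NH : Subgroup (Field.absoluteGaloisGroup K) → tf.category → ℕ+ → Prop} {A₀ : tf.category}
  {hA₀ : PreFrobenioid.IsFrobeniusTrivial tf.toElem A₀} {hA₀' : SemiGraphs.IsGaloisObj A₀.base.obj}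
  {pullFrac : ∀ {A A' : (BiKummerSetting.mkOfConnectedTemperoid X tf hZ hP NH A₀ hA₀ hA₀').C} (_ : A' ⟶ A),
    (BiKummerSetting.mkOfConnectedTemperoid X tf hZ hP NH A₀ hA₀ hA₀').biratUnits A →
      (BiKummerSetting.mkOfConnectedTemperoid X tf hZ hP NH A₀ hA₀ hA₀').biratUnits A'}
  {lv N : ℕ+} {T : ThetaEnvData.{max u₀ w} N}
  {θ : (BiKummerSetting.mkOfConnectedTemperoid X tf hZ hP NH A₀ hA₀ hA₀').biratUnits
    (BiKummerSetting.mkOfConnectedTemperoid X tf hZ hP NH A₀ hA₀ hA₀').Aodot}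
  {Bl : (BiKummerSetting.mkOfConnectedTemperoid X tf hZ hP NH A₀ hA₀ hA₀').C}
  {Pl : (BiKummerSetting.mkOfConnectedTemperoid X tf hZ hP NH A₀ hA₀ hA₀').FractionPair θ Bl}
  {Rl : (BiKummerSetting.mkOfConnectedTemperoid X tf hZ hP NH A₀ hA₀ hA₀').NthRoot θ Pl lv pullFrac}
  (h : ModelFrobenioid.Hypotheses tf.divisorMonoid tf.ratFnFunctor)
  (Q : FrobenioidTheta.ThetaSubquotientStub.{w} (ConnectedPart (BTemp X.Pi))) (odd_l : Odd (lv : ℕ))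
  (R : (BiKummerSetting.mkOfConnectedTemperoid X tf hZ hP NH A₀ hA₀ hA₀').NthRoot Rl.root Rl.pair N pullFrac)
  (ιX : T.PiX ≃ₜ* X.Pi) (K' : Type w) [Field K'] (constEmb : K'ˣ →* tf.biratUnitsModel R.BN)
  (constEmb_injective : Function.Injective constEmb)
  (hinvc : ∀ g : Aut R.AN.base,
    pull tf.divisorMonoid g.hom (ModelFrobenioid.div R.pair.num) = ModelFrobenioid.div R.pair.num)
  (hinvp : ∀ y : T.PiX, y ∈ T.PiYdd →
    pull tf.divisorMonoid ((BiKummerSetting.mkOfConnectedTemperoid X tf hZ hP NH A₀ hA₀ hA₀').galoisSurj R.AN.base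
      R.αData.isGalois (ιX y)).hom (ModelFrobenioid.div R.pair.den) = ModelFrobenioid.div R.pair.den)

include h in
/-- **`hpull` for LINEAR `φ` at the genuine §5 data `𝔉 := ofConnectedTemperoidData …`** (base of FSM-type and slim = theorems for
`B^temp(Π^tp_X)⁰`): for EVERY self-equivalence `Ψ`, every linear `φ`, every `u ∈ μ_N(A′)` with `Ψ u ∈ μ_N(Ψ A′)`: `Ψ (φ^* u) = (Ψ φ)^* (Ψ u)`
— the knits' binder `hpull` restricted to linear `φ` (`hpullLin`), residual model hypothesis `hnd` only.
[cite: MochizukiEtTh2009, Prop 5.5 p.328 (PDF p.102)] -/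
theorem hpull_of_isLinear_ofConnectedTemperoidData (hnd : IsNonDilatingOn tf.divisorMonoid)
    (Ψ : (BiKummerSetting.mkOfConnectedTemperoid X tf hZ hP NH A₀ hA₀ hA₀').C ≌
      (BiKummerSetting.mkOfConnectedTemperoid X tf hZ hP NH A₀ hA₀ hA₀').C)
    {A A' : (BiKummerSetting.mkOfConnectedTemperoid X tf hZ hP NH A₀ hA₀ hA₀').C} (φ : A ⟶ A')
    (hφ : (ofConnectedTemperoidData h Q odd_l R ιX K' constEmb constEmb_injective hinvc hinvp).IsLinear φ)
    (u : (ofConnectedTemperoidData h Q odd_l R ιX K' constEmb constEmb_injective hinvc hinvp).muTorsion A'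
      (ofConnectedTemperoidData h Q odd_l R ιX K' constEmb constEmb_injective hinvc hinvp).N)
    (hu : Functor.mapAut A' Ψ.functor (u : Aut A') ∈
      (ofConnectedTemperoidData h Q odd_l R ιX K' constEmb constEmb_injective hinvc hinvp).muTorsion (Ψ.functor.obj A')
        (ofConnectedTemperoidData h Q odd_l R ιX K' constEmb constEmb_injective hinvc hinvp).N) :
    Functor.mapAut A Ψ.functor
        ((ofConnectedTemperoidData h Q odd_l R ιX K' constEmb constEmb_injective hinvc hinvp).muTorsionPull φ
          (ofConnectedTemperoidData h Q odd_l R ιX K' constEmb constEmb_injective hinvc hinvp).N u : Aut A) =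
      ((ofConnectedTemperoidData h Q odd_l R ιX K' constEmb constEmb_injective hinvc hinvp).muTorsionPull (Ψ.functor.map φ)
          (ofConnectedTemperoidData h Q odd_l R ιX K' constEmb constEmb_injective hinvc hinvp).N ⟨_, hu⟩ : Aut (Ψ.functor.obj A)) :=
  hpull_of_isLinear_ofBiKummerData h _ Q odd_l R ιX _ _ K' constEmb constEmb_injective _ _
    QuasiTemperoid.BTempConnected.connectedPart_isOfFSMType (TemperedArithmeticGroup.isSlim_connectedPart X) hnd Ψ φ hφ u hu

end ConnectedTemperoidData

end ThetaFrobenioid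

end Literature.AnabelianGeometry.EtaleTheta

end
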